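import Summits.BirchSwinnertonDyer.BirchSwinnertonDyer.Theorems.EisensteinPrimesGoodLatticeBDPValueOfNamedFactsV25
import HarnessLib
/-!
# Crux `GoodLatticeBDPValue` (stmt-BirchSwinnertonDyer-19032), line `halves`: the crux BY NAME on the v24 surface with Hida's Theorem I
# in ONE currency (CGLS's frame `IsKatzLFunction`) — the count-neutral twin of `…OfNamedFactsV25`, for the record
# (width seat `bsd-line-x1-p1-w5` gen 5; `--supports stmt-BirchSwinnertonDyer-19032`)

* `goodLatticeBDPValue_of_namedFacts₂₅a : ⟨proofThm422 ∧ thm513_disc ∧ thm331 ∧ thmII64 ∧ thmI_mu_katzLFunction_eq_zero⟩ →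
  thm222_anacong_goodLattice_of_fullDescentDatum → ⟨prop411 ∧ cycWL ∧ Milne I 5.1 ∧ Harari 17.13 (a)⟩ → ⟨prop263 ∧ _of_five_le ∧ thm212⟩
  → Theses.EisensteinPrimes.GoodLatticeBDPValue` — thirteen Literature named facts, the Hida input read in CGLS's frame (first typing,
  p432386) instead of the reflected de Shalit frame (second typing).

THEOREMS ONLY; CONDITIONAL; closes nothing; no summit statement / BSD / the crux proved; 0 cells / labels move.
-/

-- `Summit.BirchSwinnertonDyer.BirchSwinnertonDyer.…`: the summit and its single sub-problem share a name (D-0017 layout).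
set_option linter.dupNamespace false
set_option autoImplicit false

namespace Summit.BirchSwinnertonDyer.BirchSwinnertonDyer.Theorems.GoodLatticeBDPValueOfNamedFactsV25a

open scoped Classical

open PowerSeries
  WeierstrassCurve
  NumberField
  IsDedekindDomain
  Field
  Literature.NumberTheory.GaloisRepresentations
  Literature.NumberTheory.EllipticCurves.GreenbergVatsal2000
  Summit.BirchSwinnertonDyer.BirchSwinnertonDyer.Theorems.EisensteinPrimesMuLambda
  Literature.NumberTheory.EllipticCurves
  Literature.NumberTheory.EllipticCurves.ModularForms
  Literature.NumberTheory.EllipticCurves.Rank1Residual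
  Literature.NumberTheory.EllipticCurves.Castella2018
  Literature.NumberTheory.EllipticCurves.GreenbergSelmer
  Literature.NumberTheory.QuadraticFields
  Literature.NumberTheory.EllipticCurves.CastellaGrossiLeeSkinner2022
  Literature.NumberTheory.EllipticCurves.KellerYin2024
  Literature.NumberTheory.EllipticCurves.IwasawaAlgebra
  Literature.NumberTheory.EllipticCurves.Rubin1991
  Literature.NumberTheory.EllipticCurves.DeShalit1987
  Literature.NumberTheory.EllipticCurves.Hida2010MuInvariant
  Literature.NumberTheory.EllipticCurves.BCGKPST2020
  Literature.NumberTheory.IwasawaTheory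
  Literature.NumberTheory.IwasawaTheory.Greenberg2016
  Literature.NumberTheory.IwasawaTheory.Greenberg2006
  Summit.BirchSwinnertonDyer.BirchSwinnertonDyer.Theorems
  Summit.BirchSwinnertonDyer.Rank1Residual.X1.KellerYinHalves
  Summit.BirchSwinnertonDyer.Rank1Residual.X2.ResidualDevissageModules
  Summit.BirchSwinnertonDyer.Rank1Residual.X1.KellerYinMuLambdaSplitDSFree
  Summit.BirchSwinnertonDyer.BirchSwinnertonDyer.Theorems.GoodLatticeBDPValueHalves
  Summit.BirchSwinnertonDyer.BirchSwinnertonDyer.Theorems.GoodLatticeBDPValueOfImprimitive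
  Summit.BirchSwinnertonDyer.BirchSwinnertonDyer.Theorems.GoodLatticeBDPValueOfOneInequality
  Summit.BirchSwinnertonDyer.BirchSwinnertonDyer.Theorems.GoodLatticeImprimitiveOfQuotient
  Summit.BirchSwinnertonDyer.BirchSwinnertonDyer.Theorems.GoodLatticeQuotientOfCorank
  Summit.BirchSwinnertonDyer.BirchSwinnertonDyer.Theorems.GoodLatticeCorankOfGe
  Summit.BirchSwinnertonDyer.BirchSwinnertonDyer.Theorems.GoodLatticeBDPValueOfNamedFactsV23

/-- **THE CRUX BY NAME with Hida's Theorem I cited in ONE currency — CGLS's own frame — the count-neutral, PUB-for-PUB twin of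
`…OfNamedFactsV25` on the v24 surface.** Stub 1's fifth conjunct `thmI_mu_katzBranch_reflect_eq_zero` (the 2nd typing, on the
reflected de Shalit frame) REPLACED by the 1st typing `Hida2010MuInvariant.thmI_mu_katzLFunction_eq_zero` (p432386; frame
`IsKatzLFunction`, the currency CGLS use at arXiv:2008.02571v2 TeX L1132); the `μ`-input then comes from
`GoodLatticeBDPValueKatzUnitSuppliers.katzUnitAll_of_thmI_katzLFunction ⟨Hida⟩ ⟨thm212⟩`; everything else as in
`GoodLatticeBDPValueOfNamedFactsV25.goodLatticeBDPValue_of_namedFacts₂₅`. The 2nd typing existed because «neither typed form derives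
the other in the tree»; at the line's use site the comparison is now a kernel theorem (p665992), so one currency suffices. For a
LEAD who prefers Hida BY NAME over Hida-inside-[AN]. CONDITIONAL on exactly thirteen names; closes nothing; BSD is proved for no
curve. [claim: KellerYin2024, status: under-review]
[cite: Hida2010MuInvariant, Thm. I (p. 45) (CGLS currency)] [cite: CastellaGrossiLeeSkinner2022, Thm. 2.1.2, proof of Thm. 2.2.2 (L1132)]
[cite: KellerYin2024, Thm. 3.0.8 (IMC2) and proof, Thm. 1.4.1, Thms. 2.2.1–2.2.3] [cite: deShalit1987, II.6.4 Theorem (i)]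
[cite: NeukirchSchmidtWingberg2008, (10.3.25)] [cite: Greenberg2016Selmer, Prop. 4.1.1, Prop. 2.6.3] -/
theorem goodLatticeBDPValue_of_namedFacts₂₅a
    (stub_publishedFacts :
      proofThm422_exists_isBDPLFunction_isTorsion_charIdeal_dvd ∧
        thm513_exists_isBDPLFunction_valueAtOne_disc ∧
        thm331_rubin_exists_katzMeasure₂_pseudoIso_span_eq ∧
        thmII64_katzMeasure₂_functionalEquation ∧
        thmI_mu_katzLFunction_eq_zero)
    (stub_anacongOfFullDescentDatum : thm222_anacong_goodLattice_of_fullDescentDatum)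
    (stub_publishedFactsGreenberg :
      prop411_selmer_isAlmostDivisible ∧
        Literature.NumberTheory.IwasawaTheory.weakLeopoldt_H2_subsingleton_cyclotomic_of_isOpen ∧
        (∀ (L : Type) [Field L] [NumberField L], Literature.NumberTheory.GaloisCohomology.tateGlobalEulerPoincareCharacteristic L) ∧
        (∀ (L : Type) [Field L] [NumberField L], Literature.NumberTheory.GaloisCohomology.poitouTate_restricted_three_le L))
    (stub_publishedFactsMore :
      prop263_sur_of_crk ∧ thm222_anacong_goodLattice_of_five_le ∧ thm212_exists_isKatzLFunction) :
    Summit.BirchSwinnertonDyer.BirchSwinnertonDyer.Theses.EisensteinPrimes.GoodLatticeBDPValue := by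
  -- (T4) from its cyclotomic case (w2 gen 7, p665558)
  have hT4 : weakLeopoldt_H2_subsingleton_above_cyclotomic_of_isOpen :=
    GoodLatticeBDPValueT4OfCyclotomic.above_cyclotomic_of_cyclotomic stub_publishedFactsGreenberg.2.1
  -- v22's eight Greenberg-type conjuncts (w2 gen 6, p660402; BCGKPST §3.3 from Thm. 3.3.1, w6 gen 2, p661944)
  obtain ⟨h411, h422, h5A, h41, h42, h32, h33, -⟩ :=
    GoodLatticeBDPValuePublishedFactsOfTextbook.publishedFactsGreenberg_of_textbook stub_publishedFactsGreenberg.1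
      stub_publishedFactsGreenberg.2.2.1 stub_publishedFactsGreenberg.2.2.2
      (GoodLatticeBDPValueSec33OfThm331.sec33_of_thm331 stub_publishedFacts.2.2.1) hT4
  -- [AN] at every odd `p`: 3a-A (BY NAME; the `def` unfolds to the registered text) at the datum of the CLOSED 3a-B, and the `5 ≤ p` slice
  have han : thm222_anacong_goodLattice_OPEN :=
    GoodLatticeBDPValueAnThreeBookkeeping.thm222_OPEN_of_fullDescentDatum_of_five_le stub_anacongOfFullDescentDatum
      stub_publishedFactsMore.2.1
  exact GoodLatticeBDPValueOfKatzUnit.goodLatticeBDPValue_of_print_of_leTD_of_le_of_anQ_of_katzUnit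
    stub_publishedFacts.1 stub_publishedFacts.2.1 stub_publishedFacts.2.2.1 stub_publishedFacts.2.2.2.1
    (GoodLatticeBDPValueKatzUnitSuppliers.katzUnitAll_of_thmI_katzLFunction stub_publishedFacts.2.2.2.2
      stub_publishedFactsMore.2.2)
    h411 h422 h5A h41 h42 h32 h33 hT4
    (GoodLatticeBDPValueOfNamedFactsV25.imprimLambdaLE_of_facts stub_publishedFactsMore.1 stub_publishedFactsGreenberg.2.2.1
      stub_publishedFactsGreenberg.2.2.2 h411 h422 h5A h41 h42 h32 h33 hT4)
    (prop125_imprimitive_of_quotient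
      (prop125_quotient_of_corank (prop125_corank_of_ge
        (AcTwistDeformation.prop125_residualPair_unrSelmer_corank_ge_of_facts stub_publishedFactsMore.1 h41 h42 h5A h32))))
    FSideCorankLe.stub_fSideCorankLe
    (GoodLatticeBDPValueOfNamedFactsSix.anQ_of_thm222_OPEN stub_publishedFacts.2.2.2.1 han stub_publishedFactsMore.2.2)

end Summit.BirchSwinnertonDyer.BirchSwinnertonDyer.Theorems.GoodLatticeBDPValueOfNamedFactsV25a
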